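import Summits.Ventures.Crystal3D.Theorems.StickyWulffConstantGenericWallFloorStackWalk
import Summits.Ventures.Crystal3D.Theorems.StickyWulffConstantGenericWallFloorChainLedgerSealed
import HarnessLib

/-!
# Tools for the stack ledger: walker start/end per grain, no unsaturated ball inside a complete slab,
# the flux loss of the inner start disc, and the weighted double-count of two end families

HONEST FRAMING. Part of the venture `Summits/Ventures/Crystal3D` (cell `crystal3d-full`), helper
`--supports` the crux `GenericWallFloor` (stmt-Ventures-19480) of `route-Ventures-StickyWulffConstant`,
registered line `WallLedgerG`, open stub `stub_twoSlabAdhesion` (general fillings).  Bricks for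
`…StackLedger` (`twoSlabAdhesion_stackLedger`):

* `twelve_le_card_contacts_of_full`, `not_unsaturated_in_slab` (sealing + `inner_sample_full_window`: an
  unsaturated ball off the rim is not inside a complete clamped slab);
* `walkInv_start`, `grainWalk_end` (the stack walk of one grain from a full ball along a steep slot:
  `stackWalk_end` packaged);
* `flux_loss_inner_disc` (the tops of the inner start disc of radius `ρ − 3 − (8/3)(h + 40)` still number
  `κπρ² − 2000(1+h)ρ`);
* `sum_payers_ge_two_families` (the weighted payer sum dominates `#U₁ + #U₂ − #DT₁₁` for two families of
  unsaturated balls inside the payer set).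

WHAT THIS IS NOT: not the stub; F-C1 not moved.
-/

noncomputable section

namespace Summit.Ventures.Crystal3D.Theorems

open Summit.Ventures.Crystal3D Finset
open Literature.MathematicalPhysics.StatisticalMechanics (fccStacking contactDeficiency)
open scoped InnerProductSpace

variable {X : Finset (EuclideanSpace ℝ (Fin 3))}

/-! ### Local tools -/

/-- A ball with its twelve slots occupied has at least twelve contacts. -/
theorem twelve_le_card_contacts_of_full (A : EuclideanSpace ℝ (Fin 3) ≃ₗᵢ[ℝ] EuclideanSpace ℝ (Fin 3))
    {y : EuclideanSpace ℝ (Fin 3)} (hfull : ∀ w ∈ fccSlots, y + A w ∈ X) :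
    12 ≤ (X.filter fun q => dist y q = 1).card := by
  classical
  rw [← card_fccSlots]
  refine Finset.card_le_card_of_injOn (fun w => y + A w) (fun w hw => ?_) ?_
  · rw [Finset.mem_coe, Finset.mem_filter]
    refine ⟨hfull w hw, ?_⟩
    rw [dist_self_add_right, LinearIsometryEquiv.norm_map, norm_eq_one_of_mem_fccSlots hw]
  · intro w₁ _ w₂ _ h
    exact A.injective (add_left_cancel h)

/-- **No unsaturated ball inside a complete slab.**  If `P ⊆ X` is the complete sample of `Λ = A·Λ₀ + t`
in `[a, b] × disc ρ` and `X` is `1`-separated, a ball of `X` with `a + 1 ≤ y₂ ≤ b − 1` and lateral radius²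
`≤ (ρ − 1)²` has twelve contacts. -/
theorem not_unsaturated_in_slab
    (A : EuclideanSpace ℝ (Fin 3) ≃ₗᵢ[ℝ] EuclideanSpace ℝ (Fin 3)) (t : EuclideanSpace ℝ (Fin 3))
    (a b ρ : ℝ) (hρ : 1 ≤ ρ) (X P : Finset (EuclideanSpace ℝ (Fin 3)))
    (hX : ∀ p ∈ X, ∀ q ∈ X, p ≠ q → 1 ≤ dist p q) (hPX : P ⊆ X)
    (hP : ∀ p, p ∈ P ↔ (p ∈ (fun s => A s + t) '' fccStacking 1 (Real.sqrt (2 / 3)) ∧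
      a ≤ p 2 ∧ p 2 ≤ b ∧ p 0 ^ 2 + p 1 ^ 2 ≤ ρ ^ 2))
    {y : EuclideanSpace ℝ (Fin 3)} (hyX : y ∈ X) (h1 : a + 1 ≤ y 2) (h2 : y 2 ≤ b - 1)
    (hr : y 0 ^ 2 + y 1 ^ 2 ≤ (ρ - 1) ^ 2) (hdeg : (X.filter fun q => dist y q = 1).card ≤ 11) : False := by
  by_cases hyP : y ∈ P
  · have hΛ := ((hP y).1 hyP).1
    have hfull : ∀ w ∈ fccSlots, y + A w ∈ X := fun w hw =>
      hPX (inner_sample_full_window A t P a b ρ hρ hP hΛ h1 h2 hr hw)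
    have := twelve_le_card_contacts_of_full A hfull
    omega
  · exact sealing_below A t a b ρ hρ X P hX hPX hP y hyX hyP (by linarith) h2 hr

/-- **The walker's start state satisfies the invariant.**  A ball `p ∈ X` with its twelve `A`-slots occupied
and a steep slot `u` (`⟪A u, z⟫ ≥ √2/2`) give the certified one-level state `(p + A u, [⟨A, u, 0⟩])`. -/
theorem walkInv_start (A : EuclideanSpace ℝ (Fin 3) ≃ₗᵢ[ℝ] EuclideanSpace ℝ (Fin 3))
    {z p u : EuclideanSpace ℝ (Fin 3)} (hp : p ∈ X) (hfull : ∀ w ∈ fccSlots, p + A w ∈ X)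
    (hu : u ∈ fccSlots) (hsteep : Real.sqrt 2 / 2 ≤ ⟪A u, z⟫_ℝ) :
    WalkInv X z (p + A u, [⟨A, u, 0⟩]) := by
  refine ⟨hfull u hu, ⟨hu, hsteep⟩, ⟨A, u, 0⟩, [], rfl, Or.inl ⟨?_, fun w hw => ?_⟩⟩
  · simp [hp]
  · simp only [add_sub_cancel_right]; exact hfull w hw

/-- **One grain's walker, end to end.**  `X` `1`-separated with heights `⟪q, z⟫ ≤ H`, the C12-55 row, a full
ball `p ∈ X` of the frame `A`, a steep slot `u`; with fuel `N`, `8(H − ⟪p + A u, z⟫) < 3N`, the end ball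
`y = walkEnd X z N (p + A u) [⟨A, u, 0⟩]` is in `X`, has `≤ 11` contacts, `⟪y − (p + A u), z⟫ ≥ 0` and
`‖y − (p + A u)‖ ≤ (8/3)(H − ⟪p + A u, z⟫)`. -/
theorem grainWalk_end (hX : ∀ p ∈ X, ∀ q ∈ X, p ≠ q → 1 ≤ dist p q)
    {s₀ : EuclideanSpace ℝ (Fin 3)} (hs₀ : s₀ ∈ fccSlots)
    (hcert : ExactOnly 0 (fccSlots.filter fun w => 0 < ⟪w, s₀⟫_ℝ))
    {z : EuclideanSpace ℝ (Fin 3)} (hz : ‖z‖ = 1) {H : ℝ} (hH : ∀ q ∈ X, ⟪q, z⟫_ℝ ≤ H)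
    (A : EuclideanSpace ℝ (Fin 3) ≃ₗᵢ[ℝ] EuclideanSpace ℝ (Fin 3))
    {p u : EuclideanSpace ℝ (Fin 3)} (hp : p ∈ X) (hfull : ∀ w ∈ fccSlots, p + A w ∈ X)
    (hu : u ∈ fccSlots) (hsteep : Real.sqrt 2 / 2 ≤ ⟪A u, z⟫_ℝ)
    {N : ℕ} (hN : 8 * (H - ⟪p + A u, z⟫_ℝ) < 3 * N) :
    walkEnd X z N (p + A u) [⟨A, u, 0⟩] ∈ X ∧
      (X.filter fun q => dist (walkEnd X z N (p + A u) [⟨A, u, 0⟩]) q = 1).card ≤ 11 ∧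
      0 ≤ ⟪walkEnd X z N (p + A u) [⟨A, u, 0⟩] - (p + A u), z⟫_ℝ ∧
      ‖walkEnd X z N (p + A u) [⟨A, u, 0⟩] - (p + A u)‖ ≤ 8 / 3 * (H - ⟪p + A u, z⟫_ℝ) := by
  have hInv := walkInv_start A hp hfull hu hsteep
  obtain ⟨hyX, hdeg, hrise, hdisp, -, -⟩ := stackWalk_end hX hs₀ hcert hz hH hInv hN
  unfold walkEnd
  dsimp only at hyX hdeg hrise hdisp ⊢
  refine ⟨hyX, hdeg, hrise, le_trans hdisp ?_⟩
  have : ⟪(walkRun X z N (p + A u, [⟨A, u, 0⟩])).1 - (p + A u), z⟫_ℝ ≤ H - ⟪p + A u, z⟫_ℝ := by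
    rw [inner_sub_left]; linarith [hH _ hyX]
  linarith


/-- **Flux loss of the inner start disc.**  For `0 ≤ κ ≤ 2`, `0 ≤ h`, `ρs = ρ − 3 − (8/3)(h + 40)` with
`0 ≤ ρs ≤ ρ − 1`: `κπρ² − 2000(1+h)ρ ≤ κπρs² − 10√2πρs`. -/
theorem flux_loss_inner_disc {κ h ρ ρs : ℝ} (hκ0 : 0 ≤ κ) (hκ2 : κ ≤ 2) (hh : 0 ≤ h) (hρ0 : 0 ≤ ρ)
    (hρs : ρs = ρ - 3 - 8 / 3 * (h + 4 * 10)) (hρs0 : 0 ≤ ρs) (hρsρ : ρs ≤ ρ - 1) :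
    κ * Real.pi * ρ ^ 2 - 2000 * (1 + h) * ρ ≤ κ * Real.pi * ρs ^ 2 - 10 * Real.sqrt 2 * Real.pi * ρs := by
  have hπ : Real.pi ≤ 4 := Real.pi_le_four
  have hπ0 : 0 ≤ Real.pi := Real.pi_pos.le
  have hsq : 0 ≤ Real.sqrt 2 := Real.sqrt_nonneg 2
  have hs2' : Real.sqrt 2 ≤ 2 := by
    rw [show (2 : ℝ) = Real.sqrt (2 ^ 2) by rw [Real.sqrt_sq (by norm_num)]]
    exact Real.sqrt_le_sqrt (by norm_num)
  set L : ℝ := 8 / 3 * (h + 4 * 10) with hL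
  have hL0 : 0 ≤ L := by rw [hL]; positivity
  have hκπ : κ * Real.pi ≤ 8 := by nlinarith only [hκ0, hκ2, hπ, hπ0]
  have h1 : κ * Real.pi * ρ ^ 2 - κ * Real.pi * ρs ^ 2 = κ * Real.pi * ((3 + L) * (ρ + ρs)) := by
    rw [hρs]; ring
  have h0 : 0 ≤ (3 + L) * (ρ + ρs) := mul_nonneg (by linarith only [hL0]) (by linarith only [hρ0, hρs0])
  have h2 : (3 + L) * (ρ + ρs) ≤ (3 + L) * (2 * ρ) :=
    mul_le_mul_of_nonneg_left (by linarith only [hρsρ]) (by linarith only [hL0])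
  have h3 : κ * Real.pi * ((3 + L) * (ρ + ρs)) ≤ 8 * ((3 + L) * (2 * ρ)) :=
    calc κ * Real.pi * ((3 + L) * (ρ + ρs)) ≤ 8 * ((3 + L) * (ρ + ρs)) :=
          mul_le_mul_of_nonneg_right hκπ h0
      _ ≤ 8 * ((3 + L) * (2 * ρ)) := by linarith only [h2]
  have h4 : 10 * Real.sqrt 2 * Real.pi * ρs ≤ 80 * ρ := by
    have h7 : Real.sqrt 2 * Real.pi ≤ 8 := by nlinarith only [hsq, hs2', hπ, hπ0]
    have h5 : 10 * Real.sqrt 2 * Real.pi * ρs = 10 * (Real.sqrt 2 * Real.pi) * ρs := by ring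
    rw [h5]
    have h6 : 10 * (Real.sqrt 2 * Real.pi) * ρs ≤ 10 * 8 * ρs :=
      mul_le_mul_of_nonneg_right (by linarith only [h7]) hρs0
    linarith only [h6, hρsρ]
  have hhρ : 0 ≤ h * ρ := mul_nonneg hh hρ0
  have h5 : 8 * ((3 + L) * (2 * ρ)) + 80 * ρ ≤ 2000 * (1 + h) * ρ := by
    rw [hL]; linarith only [hρ0, hhρ]
  linarith only [h1, h3, h4, h5]

open scoped Classical in
/-- **Two families of unsaturated payers, weighted.**  If `U₁, U₂ ⊆ PAY`, every ball of `PAY` has `≠ 12`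
(hence `≤ 11`) contacts in the `1`-separated `X`, and `DT` contains every ball of `U₁ ∩ U₂` with exactly
eleven contacts, then `#U₁ + #U₂ − #DT ≤ Σ_{y ∈ PAY} (12 − deg y)`. -/
theorem sum_payers_ge_two_families (hX : ∀ p ∈ X, ∀ q ∈ X, p ≠ q → 1 ≤ dist p q)
    {PAY U₁ U₂ DT : Finset (EuclideanSpace ℝ (Fin 3))} (hU₁P : U₁ ⊆ PAY) (hU₂P : U₂ ⊆ PAY)
    (hPAY : ∀ y ∈ PAY, (X.filter fun q => dist y q = 1).card ≠ 12)
    (hUU : ∀ y ∈ U₁ ∩ U₂, (X.filter fun q => dist y q = 1).card = 11 → y ∈ DT) :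
    (U₁.card : ℝ) + U₂.card - DT.card ≤ ∑ y ∈ PAY, ((12 : ℝ) - ((X.filter fun q => dist y q = 1).card : ℝ)) := by
  set deg : EuclideanSpace ℝ (Fin 3) → ℕ := fun x => (X.filter fun q => dist x q = 1).card with hdeg
  have hdeg12 : ∀ x, deg x ≤ 12 := fun x => card_filter_dist_eq_one_le_twelve X hX x
  show (U₁.card : ℝ) + U₂.card - DT.card ≤ ∑ y ∈ PAY, ((12 : ℝ) - (deg y : ℝ))
  have hpt : ∀ y ∈ U₁ ∪ U₂, ((if y ∈ U₁ then (1 : ℝ) else 0) + (if y ∈ U₂ then (1 : ℝ) else 0) -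
      (if y ∈ DT then (1 : ℝ) else 0)) ≤ (12 : ℝ) - (deg y : ℝ) := by
    intro y hy
    have hne : deg y ≠ 12 := by
      rcases Finset.mem_union.1 hy with h' | h'
      · exact hPAY y (hU₁P h')
      · exact hPAY y (hU₂P h')
    have hle : deg y ≤ 11 := by have := hdeg12 y; omega
    have h11r : (deg y : ℝ) ≤ 11 := by exact_mod_cast hle
    by_cases hb : y ∈ U₁ ∧ y ∈ U₂
    · rw [if_pos hb.1, if_pos hb.2]
      by_cases h11 : deg y = 11
      · rw [if_pos (hUU y (Finset.mem_inter.2 hb) h11), h11]; norm_num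
      · have : (deg y : ℝ) ≤ 10 := by exact_mod_cast (by omega : deg y ≤ 10)
        have h0 : (0 : ℝ) ≤ (if y ∈ DT then (1 : ℝ) else 0) := by split_ifs <;> norm_num
        linarith
    · have h0 : (0 : ℝ) ≤ (if y ∈ DT then (1 : ℝ) else 0) := by split_ifs <;> norm_num
      have h2 : (if y ∈ U₁ then (1 : ℝ) else 0) + (if y ∈ U₂ then (1 : ℝ) else 0) ≤ 1 := by
        rw [not_and_or] at hb
        rcases hb with h' | h'
        · rw [if_neg h']; split_ifs <;> norm_num
        · rw [if_neg h']; split_ifs <;> norm_num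
      linarith
  have hsum := Finset.sum_le_sum hpt
  rw [Finset.sum_sub_distrib, Finset.sum_add_distrib] at hsum
  have e1 : ∑ y ∈ U₁ ∪ U₂, (if y ∈ U₁ then (1 : ℝ) else 0) = U₁.card := by
    rw [Finset.sum_boole, Finset.filter_mem_eq_inter, Finset.inter_eq_right.2 Finset.subset_union_left]
  have e2 : ∑ y ∈ U₁ ∪ U₂, (if y ∈ U₂ then (1 : ℝ) else 0) = U₂.card := by
    rw [Finset.sum_boole, Finset.filter_mem_eq_inter, Finset.inter_eq_right.2 Finset.subset_union_right]
  have e3 : ∑ y ∈ U₁ ∪ U₂, (if y ∈ DT then (1 : ℝ) else 0) ≤ DT.card := by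
    rw [Finset.sum_boole]
    have hsubDT : ((U₁ ∪ U₂).filter fun y => y ∈ DT) ⊆ DT := fun y hy => (Finset.mem_filter.1 hy).2
    exact_mod_cast Finset.card_le_card hsubDT
  have e4 : ∑ y ∈ U₁ ∪ U₂, ((12 : ℝ) - (deg y : ℝ)) ≤ ∑ y ∈ PAY, ((12 : ℝ) - (deg y : ℝ)) :=
    Finset.sum_le_sum_of_subset_of_nonneg (Finset.union_subset hU₁P hU₂P) fun y _ _ => by
      have : (deg y : ℝ) ≤ 12 := by exact_mod_cast hdeg12 y
      linarith
  linarith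

end Summit.Ventures.Crystal3D.Theorems

end
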